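import Mathlib.GroupTheory.DoubleCoset
import Mathlib.GroupTheory.Index
import Mathlib.Topology.Algebra.OpenSubgroup
import Mathlib.Algebra.Module.NatInt
import Literature.NumberTheory.Automorphic.SmoothInduction
import HarnessLib

/-!
# Smooth induction is an exact functor
(sibling proof file of `Literature.NumberTheory.Automorphic.SmoothInduction`, item I5)

Let `G` be a topological group, `H ≤ G` a subgroup and `Ind_H^G = Representation.smoothIndRep H`
the smooth induction of `SmoothInduction` (right-translation-smooth functions `f : G → W` with
`f (h g) = σ h (f g)`). This file makes `Ind_H^G` a functor and proves that it is exact: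

* `Representation.smoothIndMap H φ : Ind_H^G σ →ᵢ Ind_H^G σ'` — the intertwining map
  `f ↦ φ ∘ f` induced by an `H`-map `φ : σ →ᵢ σ'` (Mathlib's `Representation.coindMap` on the
  algebraic induction, restricted to smooth vectors: the stabiliser of `φ ∘ f` contains that of
  `f`), with `toFun_smoothIndMap`, `smoothIndMap_id`, `smoothIndMap_comp`;
* `Representation.smoothIndMap_injective` — `Ind` preserves injections;
* `Representation.smoothIndMap_exact` — `Ind` preserves exactness in the middle of a short exact
  sequence `0 → σ₁ → σ₂ → σ₃` (for `f` killed by `Ind ψ`, `f = φ ∘ u` pointwise with `u` unique,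
  hence `H`-equivariant and with the same stabiliser as `f`);
* `Representation.smoothIndMap_surjective` — **`Ind` preserves surjections** `ψ : σ ↠ σ''` when
  `k` is a field of characteristic `0`, `H` is closed, `G` has a compact open subgroup and `σ`
  is smooth. Proof: a smooth `f'' ∈ Ind σ''` is right-invariant under a compact open subgroup
  `K`; on each double coset `H g K` it is determined by `f''(g)`, a vector fixed by the compact
  open subgroup `K_g = H ∩ g K g⁻¹` of `H`; a `σ(K_g)`-fixed preimage `w_g` of `f''(g)` exists by
  **finite averaging** over `K_g / S`, `S` a normal subgroup of finite index of `K_g` fixing a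
  smooth preimage (`exists_forall_apply_eq_and_apply_eq`, the only place where characteristic `0`
  enters); then `h g κ ↦ σ(h) w_g` is a well-defined element of `Ind σ` mapping to `f''`
  (the same bookkeeping of double cosets `H \ G / K` as in
  `Representation.finite_fixedPoints_smoothIndRep` of `SmoothInductionProofs`).

This is the statement "(a) The functors `I_{U,θ}`, `i_{U,θ}` are exact" of Bernstein–Zelevinsky
1977, Proposition 1.9, p. 445 (for `I`, in the generality of an arbitrary closed subgroup `H` of
a topological group with a compact open subgroup; Bernstein–Zelevinsky induce from `P = M U` the
representation `θ mod_U^{1/2} ρ` of `P`, 1.8 (a) (1), which is our `σ`, and their condition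
1.8 (a) (2), "there exists an open subgroup `K_f ⊂ G` such that `f(gk) = f(g)`", is exactly
membership in the smooth part `smoothInd`), whose proof is referred there (p. 445) to "[1],
chap. I", i.e. Bernstein–Zelevinsky 1976. The specialisation to the normalised parabolic
induction `Representation.parabolicIndGL` of `GL_n` (Bernstein–Zelevinsky 1977,
Proposition 2.3 (a), p. 446) is in `ParabolicGLExactProofs`.

All statements are proved; the only definition is the real one `smoothIndMap`; no named facts.

## References

* I. N. Bernstein, A. V. Zelevinsky, *Induced representations of reductive `p`-adic groups I*,
  Ann. Sci. ÉNS (4) 10 (1977), 441–472, §1.8 and Proposition 1.9 (a), p. 445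
  [BernsteinZelevinsky1977].
* I. N. Bernstein, A. V. Zelevinsky, *Representations of the group `GL(n, F)` where `F` is a
  non-archimedean local field*, Russian Math. Surveys 31:3 (1976), 1–68, chap. I
  [BernsteinZelevinsky1976] (not held here; cited only through the locator "[1], chap. I"
  printed in the 1977 paper).
-/

open Topology Function

namespace Representation

/-! ### Finite averaging over a compact subgroup -/

section Averaging

variable {k C V : Type*} [CommRing k] [Group C] [AddCommGroup V] [Module k V]

/-- **Finite averaging is invariant under left translation.** Let `ρ` be a representation of a
group `C`, `S ⊴ C` of finite index and `w` a vector fixed by `S`. Then for `m ∈ C`,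
`ρ(m) ∑_{q ∈ C/S} ρ(q̃) w = ∑_{q ∈ C/S} ρ(q̃) w` for any choice of representatives `q̃` (here
`Quotient.out`): left multiplication by `m` permutes `C/S`, and changing a representative by an
element of `S` does not change `ρ(·) w`. (The finite form of `∫_K ρ(m k) w dk = ∫_K ρ(k) w dk`;
companion of `Representation.sum_quotient_out_hom_apply_apply` of `JacquetModuleExactProofs`.)
[folklore] -/
theorem apply_sum_quotient_out_apply (ρ : Representation k C V) (S : Subgroup C) [S.Normal]
    [Fintype (C ⧸ S)] {w : V} (hS : ∀ s ∈ S, ρ s w = w) (m : C) :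
    ρ m (∑ q : C ⧸ S, ρ q.out w) = ∑ q : C ⧸ S, ρ q.out w := by
  rw [map_sum]
  have key : ∀ q : C ⧸ S, ρ m (ρ q.out w) = ρ ((QuotientGroup.mk m : C ⧸ S) * q).out w := by
    intro q
    obtain ⟨s, hs⟩ := QuotientGroup.mk_out_eq_mul S (m * q.out)
    have hq : (QuotientGroup.mk (m * q.out) : C ⧸ S) = QuotientGroup.mk m * q := by
      rw [QuotientGroup.mk_mul, QuotientGroup.out_eq']
    rw [← hq, hs, map_mul, map_mul, Module.End.mul_apply, Module.End.mul_apply, hS s s.2]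
  simp_rw [key]
  exact Fintype.sum_equiv (Equiv.mulLeft (QuotientGroup.mk m : C ⧸ S)) _ _ fun _ => rfl

end Averaging

section AveragingLift

variable {k H V V'' : Type*} [Field k] [CharZero k] [Group H] [TopologicalSpace H]
  [IsTopologicalGroup H] [AddCommGroup V] [Module k V] [AddCommGroup V''] [Module k V'']
  {ρ : Representation k H V} {ρ'' : Representation k H V''}

/-- **Invariant lifts by finite averaging** (characteristic `0`). Let `C ≤ H` be a subgroup which
is compact (in the subspace topology), `ψ : ρ → ρ''` an `H`-map, and `w` a smooth vector of `ρ`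
whose image `ψ w` is fixed by `C`. Then there is a `C`-fixed vector `w₀` with `ψ w₀ = ψ w`:
the stabiliser of `w` meets `C` in an open subgroup of finite index, whose normal core `S ⊴ C`
still has finite index, and `w₀ = |C/S|⁻¹ ∑_{q ∈ C/S} ρ(q̃) w` works
(`apply_sum_quotient_out_apply`; `ψ (ρ q̃ w) = ρ'' q̃ (ψ w) = ψ w`). This is the surjectivity of
`V^C → (V'')^C` for a surjection of smooth representations of a compact group, i.e. the
exactness of `C`-invariants by the averaging projector `e_C`, in the finite form that needs no
Haar measure (the same device as `Representation.jacquetMap_injective` of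
`JacquetModuleExactProofs`). [folklore] -/
theorem exists_forall_apply_eq_and_apply_eq (C : Subgroup H) [CompactSpace C]
    (ψ : ρ.IntertwiningMap ρ'') {w : V} (hw : ρ.IsSmoothVector w)
    (hψw : ∀ c ∈ C, ρ'' c (ψ w) = ψ w) :
    ∃ w₀ : V, (∀ c ∈ C, ρ c w₀ = w₀) ∧ ψ w₀ = ψ w := by
  classical
  -- the open subgroup of `C` fixing `w`, and a normal subgroup of finite index inside it
  let U : Subgroup C := (ρ.stabilizerSubgroup w).comap C.subtype
  have hUo : IsOpen (U : Set C) := hw.preimage continuous_subtype_val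
  haveI : U.FiniteIndex :=
    @Subgroup.finiteIndex_of_finite_quotient _ _ U (Subgroup.quotient_finite_of_isOpen U hUo)
  let S : Subgroup C := U.normalCore
  haveI : Fintype (C ⧸ S) := Fintype.ofFinite _
  let ρC : Representation k C V := ρ.comp C.subtype
  have hS : ∀ s ∈ S, ρC s w = w := fun s hs => by
    have h := U.normalCore_le hs
    rwa [Subgroup.mem_comap, mem_stabilizerSubgroup] at h
  -- the averaged vector
  refine ⟨((Fintype.card (C ⧸ S) : ℕ) : k)⁻¹ • ∑ q : C ⧸ S, ρC q.out w, fun c hc => ?_, ?_⟩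
  · rw [map_smul]
    exact congrArg _ (apply_sum_quotient_out_apply ρC S hS ⟨c, hc⟩)
  · have hq : ∀ q : C ⧸ S, ψ (ρC q.out w) = ψ w := fun q => by
      change ψ (ρ ((q.out : C) : H) w) = ψ w
      rw [ψ.isIntertwining, hψw _ (q.out : C).2]
    rw [map_smul, map_sum]
    simp_rw [hq]
    rw [Finset.sum_const, Finset.card_univ, ← Nat.cast_smul_eq_nsmul k, smul_smul,
      inv_mul_cancel₀ (Nat.cast_ne_zero.2 Fintype.card_ne_zero), one_smul]

end AveragingLift

/-! ### Functoriality of smooth induction -/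

section Functoriality

variable {k G W₁ W₂ W₃ : Type*} [CommRing k] [Group G] [TopologicalSpace G]
  [SeparatelyContinuousMul G] [AddCommGroup W₁] [Module k W₁] [AddCommGroup W₂] [Module k W₂]
  [AddCommGroup W₃] [Module k W₃] (H : Subgroup G) {σ₁ : Representation k H W₁}
  {σ₂ : Representation k H W₂} {σ₃ : Representation k H W₃}

/-- Post-composition with an `H`-map preserves smooth vectors of the algebraic induction: the
stabiliser of `φ ∘ f` under right translation contains that of `f`. [folklore] -/
lemma isSmoothVector_coindMap (φ : σ₁.IntertwiningMap σ₂) {f : coindV H.subtype σ₁}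
    (hf : (indFun H σ₁).IsSmoothVector f) :
    (indFun H σ₂).IsSmoothVector (coindMap H.subtype φ f) := by
  refine (indFun H σ₂).isSmoothVector_of_le hf fun g hg => ?_
  rw [mem_stabilizerSubgroup] at hg ⊢
  refine Subtype.ext (funext fun x => ?_)
  have h := congrArg (fun e : coindV H.subtype σ₁ => (e : G → W₁) x) hg
  simp only [indFun_apply_apply] at h
  change φ ((f : G → W₁) (x * g)) = φ ((f : G → W₁) x)
  rw [h]

/-- **Functoriality of smooth induction**: an `H`-intertwining map `φ : σ₁ → σ₂` induces the
`G`-intertwining map `Ind_H^G φ : Ind_H^G σ₁ → Ind_H^G σ₂`, `f ↦ φ ∘ f` (Mathlib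
`Representation.coindMap` restricted to the smooth parts). (Bernstein–Zelevinsky 1977, §1.8: the
functors `I_{U,θ}`, `i_{U,θ}`.) [cite: BernsteinZelevinsky1977, §1.8] -/
def smoothIndMap (φ : σ₁.IntertwiningMap σ₂) :
    (smoothIndRep H σ₁).IntertwiningMap (smoothIndRep H σ₂) where
  toLinearMap :=
    { toFun := fun f => show SmoothInd H σ₂ from
        ⟨coindMap H.subtype φ (show ↥(smoothInd H σ₁).toSubmodule from f).1,
          isSmoothVector_coindMap H φ (show ↥(smoothInd H σ₁).toSubmodule from f).2⟩
      map_add' := fun _ _ => SmoothInd.ext (funext fun _ => map_add φ _ _)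
      map_smul' := fun _ _ => SmoothInd.ext (funext fun _ => map_smul φ _ _) }
  isIntertwining' _ := LinearMap.ext fun _ => SmoothInd.ext (funext fun _ => rfl)

/-- Pointwise formula: `(Ind φ f) x = φ (f x)`. [folklore] -/
@[simp] lemma toFun_smoothIndMap (φ : σ₁.IntertwiningMap σ₂) (f : SmoothInd H σ₁) (x : G) :
    (smoothIndMap H φ f).toFun x = φ (f.toFun x) := rfl

/-- `Ind` of the identity is the identity. [folklore] -/
lemma smoothIndMap_id : smoothIndMap H (IntertwiningMap.id σ₁) = IntertwiningMap.id _ :=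
  IntertwiningMap.ext (LinearMap.ext fun _ => SmoothInd.ext (funext fun _ => rfl))

/-- `Ind` is compatible with composition. [folklore] -/
lemma smoothIndMap_comp (ψ : σ₂.IntertwiningMap σ₃) (φ : σ₁.IntertwiningMap σ₂) :
    smoothIndMap H (ψ.comp φ) = (smoothIndMap H ψ).comp (smoothIndMap H φ) :=
  IntertwiningMap.ext (LinearMap.ext fun _ => SmoothInd.ext (funext fun _ => rfl))

/-- **`Ind` preserves injections.** (Bernstein–Zelevinsky 1977, Prop. 1.9 (a).)
[cite: BernsteinZelevinsky1977, Prop. 1.9(a)] -/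
theorem smoothIndMap_injective {φ : σ₁.IntertwiningMap σ₂} (hφ : Function.Injective φ) :
    Function.Injective (smoothIndMap H φ) := fun f g hfg =>
  SmoothInd.ext (funext fun x => hφ (by
    simpa only [toFun_smoothIndMap] using congrArg (fun e : SmoothInd H σ₂ => e.toFun x) hfg))

/-- **`Ind` is exact in the middle**: if `φ : σ₁ → σ₂` is injective and `im φ = ker ψ` for
`ψ : σ₂ → σ₃`, then `im (Ind φ) = ker (Ind ψ)`. For `f ∈ Ind σ₂` killed by `Ind ψ` one has
`f = φ ∘ u` pointwise with `u : G → W₁` unique (`φ` injective); uniqueness makes `u`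
`H`-equivariant and gives it the stabiliser of `f`, so `u ∈ Ind σ₁`.
(Bernstein–Zelevinsky 1977, Prop. 1.9 (a).) [cite: BernsteinZelevinsky1977, Prop. 1.9(a)] -/
theorem smoothIndMap_exact {φ : σ₁.IntertwiningMap σ₂} {ψ : σ₂.IntertwiningMap σ₃}
    (hφ : Function.Injective φ) (hφψ : Function.Exact φ ψ) :
    Function.Exact (smoothIndMap H φ) (smoothIndMap H ψ) := by
  intro f
  constructor
  · intro hf
    have hx : ∀ x, ∃ u, φ u = f.toFun x := fun x => by
      refine (hφψ (f.toFun x)).1 ?_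
      have h0 : (0 : SmoothInd H σ₃).toFun x = 0 := rfl
      simpa only [toFun_smoothIndMap, h0] using congrArg (fun e : SmoothInd H σ₃ => e.toFun x) hf
    choose u hu using hx
    have hmem : u ∈ coindV H.subtype σ₁ := by
      refine (mem_indFun_iff H σ₁ u).2 fun h x => hφ ?_
      rw [hu, φ.isIntertwining, hu]
      exact f.toFun_subgroup_mul h x
    have hsmooth : (indFun H σ₁).IsSmoothVector ⟨u, hmem⟩ := by
      refine (indFun H σ₁).isSmoothVector_of_le
        (K := (smoothIndRep H σ₂).stabilizerSubgroup f) (isSmooth_smoothInd H σ₂ f) fun g hg => ?_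
      rw [mem_stabilizerSubgroup] at hg ⊢
      refine Subtype.ext (funext fun x => hφ ?_)
      have h := congrArg (fun e : SmoothInd H σ₂ => e.toFun x) hg
      simp only [toFun_smoothIndRep_apply] at h
      change φ (u (x * g)) = φ (u x)
      rw [hu, hu, h]
    refine ⟨show SmoothInd H σ₁ from ⟨⟨u, hmem⟩, hsmooth⟩, SmoothInd.ext (funext fun x => ?_)⟩
    exact hu x
  · rintro ⟨u, rfl⟩
    refine SmoothInd.ext (funext fun x => ?_)
    simp only [toFun_smoothIndMap]
    exact hφψ.apply_apply_eq_zero (u.toFun x)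

end Functoriality

/-! ### Right exactness -/

section Surjective

variable {k G W W'' : Type*} [Field k] [CharZero k] [Group G] [TopologicalSpace G]
  [IsTopologicalGroup G] [AddCommGroup W] [Module k W] [AddCommGroup W''] [Module k W'']
  (H : Subgroup G) {σ : Representation k H W} {σ'' : Representation k H W''}

/-- **`Ind` preserves surjections** (right exactness of smooth induction). Let `k` be a field of
characteristic `0`, `G` a topological group with a compact open subgroup `K₀`, `H ≤ G` a closed
subgroup, `σ` a *smooth* representation of `H` and `ψ : σ → σ''` a surjective `H`-map. Then
`Ind_H^G ψ : Ind_H^G σ → Ind_H^G σ''` is surjective. Given `f'' ∈ Ind σ''`, right-invariant under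
the compact open `K = K₀ ∩ Stab(f'')`, choose for every double coset `i = H gᵢ K` a
`σ(H ∩ gᵢ K gᵢ⁻¹)`-fixed preimage `wᵢ` of `f''(gᵢ)` (`exists_forall_apply_eq_and_apply_eq`:
`H ∩ gᵢ K gᵢ⁻¹` is compact open in `H` and `f''(gᵢ)` is fixed by it); then
`F (h gᵢ κ) := σ(h) wᵢ` is well defined, lies in `Ind σ` (it is `K`-invariant) and
`ψ ∘ F = f''`. (Bernstein–Zelevinsky 1977, Prop. 1.9 (a): "The functors `I_{U,θ}`, `i_{U,θ}` are
exact"; proof in Bernstein–Zelevinsky 1976, chap. I.) [cite: BernsteinZelevinsky1977, Prop. 1.9(a)] -/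
theorem smoothIndMap_surjective (hH : IsClosed (H : Set G)) {K₀ : Subgroup G}
    (hK₀o : IsOpen (K₀ : Set G)) (hK₀c : IsCompact (K₀ : Set G)) (hσ : σ.IsSmooth)
    {ψ : σ.IntertwiningMap σ''} (hψ : Function.Surjective ψ) :
    Function.Surjective (smoothIndMap H ψ) := by
  classical
  intro f''
  -- the compact open subgroup `K = K₀ ∩ Stab(f'')`, under which `f''` is right-invariant
  let K : Subgroup G := K₀ ⊓ (smoothIndRep H σ'').stabilizerSubgroup f''
  have hKo : IsOpen (K : Set G) := hK₀o.inter (isSmooth_smoothInd H σ'' f'')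
  have hKc : IsCompact (K : Set G) :=
    hK₀c.of_isClosed_subset (K.isClosed_of_isOpen hKo) fun _ hx => hx.1
  have hf : ∀ κ ∈ K, ∀ x : G, f''.toFun (x * κ) = f''.toFun x := by
    intro κ hκ x
    have h1 : smoothIndRep H σ'' κ f'' = f'' := hκ.2
    have h2 := congrArg (fun e : SmoothInd H σ'' => e.toFun x) h1
    simpa only [toFun_smoothIndRep_apply] using h2
  -- the continuous homomorphisms `h ↦ g⁻¹ h g : H →* G`
  let φ : G → (H →* G) := fun g =>
    { toFun := fun h => g⁻¹ * h * g
      map_one' := by simp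
      map_mul' := fun a b => by
        simp only [Subgroup.coe_mul]
        group }
  have hφ : ∀ g, Continuous (φ g) := fun g =>
    show Continuous fun h : H => g⁻¹ * (h : G) * g from
      (continuous_const.mul continuous_subtype_val).mul continuous_const
  -- the compact open subgroups `Kᵢ = H ∩ gᵢ K gᵢ⁻¹` of `H`, `gᵢ = i.out`
  let K' : DoubleCoset.Quotient (H : Set G) (K : Set G) → Subgroup H := fun i => K.comap (φ i.out)
  have hmemK' : ∀ (i : DoubleCoset.Quotient (H : Set G) (K : Set G)) (h : H),
      h ∈ K' i ↔ (i.out)⁻¹ * (h : G) * i.out ∈ K := fun _ _ => Iff.rfl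
  have hK'c : ∀ i, IsCompact ((K' i : Subgroup H) : Set H) := by
    intro i
    have h1 : IsCompact ((fun x : G => (i.out)⁻¹ * x * i.out) ⁻¹' (K : Set G)) :=
      ((Homeomorph.mulLeft (i.out)⁻¹).trans (Homeomorph.mulRight i.out)).isCompact_preimage.2
        hKc
    exact hH.isClosedEmbedding_subtypeVal.isCompact_preimage h1
  -- every `x ∈ G` decomposes as `h * gᵢ * κ`
  have hcov : ∀ x : G, ∃ (i : DoubleCoset.Quotient (H : Set G) (K : Set G)) (h : H) (κ : G),
      κ ∈ K ∧ x = h * i.out * κ := by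
    intro x
    obtain ⟨h, κ, hh, hκ, hx⟩ := DoubleCoset.mk_out_eq_mul H K x
    refine ⟨DoubleCoset.mk H K x, ⟨h⁻¹, H.inv_mem hh⟩, κ⁻¹, K.inv_mem hκ, ?_⟩
    rw [hx]
    group
  choose idx hh κκ hκκ hx using hcov
  -- two decompositions have the same double coset index
  have huniq : ∀ (i j : DoubleCoset.Quotient (H : Set G) (K : Set G)) (a b : G), a ∈ H → b ∈ H →
      ∀ (c d : G), c ∈ K → d ∈ K → a * i.out * c = b * j.out * d → i = j := by
    intro i j a b ha hb c d hc hd he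
    rw [← DoubleCoset.out_eq' H K i, ← DoubleCoset.out_eq' H K j, DoubleCoset.eq]
    refine ⟨b⁻¹ * a, H.mul_mem (H.inv_mem hb) ha, c * d⁻¹, K.mul_mem hc (K.inv_mem hd), ?_⟩
    have : j.out = b⁻¹ * (a * i.out * c) * d⁻¹ := by rw [he]; group
    rw [this]
    group
  -- ... and then the `H`-components act in the same way on `σ(Kᵢ)`-fixed vectors
  have hkey : ∀ (i : DoubleCoset.Quotient (H : Set G) (K : Set G)) (a b : H) (c d : G),
      c ∈ K → d ∈ K → (a : G) * i.out * c = b * i.out * d →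
      ∀ w : W, (∀ h ∈ K' i, σ h w = w) → σ a w = σ b w := by
    intro i a b c d hc hd he w hw
    have hmem : b⁻¹ * a ∈ K' i := by
      rw [hmemK', Subgroup.coe_mul, Subgroup.coe_inv]
      have he' : (b : G)⁻¹ * ((a : G) * i.out * c) * c⁻¹ =
          (b : G)⁻¹ * ((b : G) * i.out * d) * c⁻¹ := by
        rw [he]
      have : (i.out)⁻¹ * ((b : G)⁻¹ * a) * i.out = d * c⁻¹ := by
        calc (i.out)⁻¹ * ((b : G)⁻¹ * a) * i.out
            = (i.out)⁻¹ * ((b : G)⁻¹ * ((a : G) * i.out * c) * c⁻¹) := by group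
          _ = (i.out)⁻¹ * ((b : G)⁻¹ * ((b : G) * i.out * d) * c⁻¹) := by rw [he']
          _ = d * c⁻¹ := by group
      rw [this]
      exact K.mul_mem hd (K.inv_mem hc)
    calc σ a w = σ b (σ (b⁻¹ * a) w) := by
          rw [← Module.End.mul_apply, ← map_mul, mul_inv_cancel_left]
      _ = σ b w := by rw [hw _ hmem]
  -- `f''(gᵢ)` is fixed by `σ''(Kᵢ)`
  have hw'' : ∀ (i : DoubleCoset.Quotient (H : Set G) (K : Set G)),
      ∀ h ∈ K' i, σ'' h (f''.toFun i.out) = f''.toFun i.out := by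
    intro i h hh'
    rw [hmemK'] at hh'
    rw [← SmoothInd.toFun_subgroup_mul]
    have : (h : G) * i.out = i.out * ((i.out)⁻¹ * (h : G) * i.out) := by group
    rw [this, hf _ hh']
  -- `σ(Kᵢ)`-fixed preimages `wᵢ` of the `f''(gᵢ)` (finite averaging, characteristic `0`)
  have hex : ∀ i : DoubleCoset.Quotient (H : Set G) (K : Set G),
      ∃ w₀ : W, (∀ h ∈ K' i, σ h w₀ = w₀) ∧ ψ w₀ = f''.toFun i.out := by
    intro i
    obtain ⟨w, hw⟩ := hψ (f''.toFun i.out)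
    haveI : CompactSpace (K' i) := isCompact_iff_compactSpace.1 (hK'c i)
    obtain ⟨w₀, h1, h2⟩ := exists_forall_apply_eq_and_apply_eq (K' i) ψ (hσ w)
      (fun c hc => by rw [hw]; exact hw'' i c hc)
    exact ⟨w₀, h1, h2.trans hw⟩
  choose w hwfix hwψ using hex
  -- the candidate preimage `F x = σ(h(x)) w_{i(x)}` for `x = h(x) g_{i(x)} κ(x)`
  let F : G → W := fun x => σ (hh x) (w (idx x))
  have hF_mul_left : ∀ (h : H) (x : G), F (h * x) = σ h (F x) := by
    intro h x
    have e1 := hx (h * x)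
    have e2 : (h : G) * x = ((h * hh x : H) : G) * (idx x).out * κκ x := by
      conv_lhs => rw [hx x]
      simp only [Subgroup.coe_mul, mul_assoc]
    have e3 := e1.symm.trans e2
    have hij : idx (h * x) = idx x :=
      huniq _ _ _ _ (hh (h * x)).2 (h * hh x).2 _ _ (hκκ (h * x)) (hκκ x) e3
    rw [hij] at e3
    change σ (hh (h * x)) (w (idx (h * x))) = σ h (σ (hh x) (w (idx x)))
    rw [hij, hkey (idx x) (hh (h * x)) (h * hh x) _ _ (hκκ _) (hκκ _) e3 _ (hwfix (idx x)),
      map_mul, Module.End.mul_apply]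
  have hF_mul_right : ∀ (x κ : G), κ ∈ K → F (x * κ) = F x := by
    intro x κ hκ
    have e1 := hx (x * κ)
    have e2 : x * κ = (hh x : G) * (idx x).out * (κκ x * κ) := by
      conv_lhs => rw [hx x]
      simp only [mul_assoc]
    have e3 := e1.symm.trans e2
    have hij : idx (x * κ) = idx x :=
      huniq _ _ _ _ (hh (x * κ)).2 (hh x).2 _ _ (hκκ (x * κ)) (K.mul_mem (hκκ x) hκ) e3
    rw [hij] at e3
    change σ (hh (x * κ)) (w (idx (x * κ))) = σ (hh x) (w (idx x))
    rw [hij, hkey (idx x) (hh (x * κ)) (hh x) _ _ (hκκ _) (K.mul_mem (hκκ x) hκ) e3 _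
      (hwfix (idx x))]
  -- `F` lies in `Ind σ`: it is `H`-equivariant and `K`-fixed, hence smooth
  have hF_mem : F ∈ coindV H.subtype σ := (mem_indFun_iff H σ _).2 fun h x => hF_mul_left h x
  have hF_fix : (⟨F, hF_mem⟩ : coindV H.subtype σ) ∈ (indFun H σ).fixedPoints K := by
    rw [mem_fixedPoints]
    intro κ hκ
    exact Subtype.ext (funext fun x => hF_mul_right x κ hκ)
  have hF_smooth : (indFun H σ).IsSmoothVector (⟨F, hF_mem⟩ : coindV H.subtype σ) :=
    (indFun H σ).isSmoothVector_of_mem_fixedPoints hKo hF_fix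
  refine ⟨show ↥(smoothInd H σ).toSubmodule from ⟨⟨F, hF_mem⟩, hF_smooth⟩,
    SmoothInd.ext (funext fun x => ?_)⟩
  -- `ψ ∘ F = f''`
  rw [toFun_smoothIndMap]
  change ψ (σ (hh x) (w (idx x))) = f''.toFun x
  rw [ψ.isIntertwining, hwψ, ← SmoothInd.toFun_subgroup_mul,
    ← hf (κκ x) (hκκ x) ((hh x : G) * (idx x).out), ← hx x]

end Surjective

end Representation
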